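import Summits.ResolutionOfSingularities.ResolutionOfSingularities.Theorems.PurelyInseparableDim4IsolatedBand
import HarnessLib

/-!
# The free-tail frame of CARD I-7-2 (cell `res-dim4-pi`, res-dim4-idea-7): witnessed Step0 chains,
# satellite / free steps, and the band statement K2 at `q = p = 3` — STATEMENTS + their pure-logic assembly

[OURS · CANDIDATE FRAME · counted 0]  Nothing here proves `NoIsolatedTrap` or resolution of singularities
in dimension ≥ 4 / characteristic `p`.  This module TYPES the statements of CARD I-7-2 over the tree's F4-I
frame (`PIDim4.State`, `Step0`, `IsIsolated` of the Scope add-on, `CentreBlowup.step`,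
`Hauser2010.ordZero`) so that prover bricks can conclude them BY NAME (res-dim4-p-9 takes `ShapeLemma3`,
I-7-2 offer (a); offer (b) `NoIsolatedFreeTail` is the frozen-monomial argument of
`IsoSpine.frozenMonomialLemma` run in arc-adapted formal coordinates); the hand proofs are in
`pub/res-dim4/cards/idea-7.md`.  Contents:

* `IsWitnessedChain q c j b` — the Step0 chain `c` with its chart / translation witnesses;
* `IsSatellite j b k` — step `k+1` keeps the divisor `{x_{j k} = 0}` created at step `k`
  (`j (k+1) ≠ j k ∧ b (k+1) (j k) = 0`); FREE otherwise;
* `SatelliteRecurrence q` / `NoIsolatedFreeTail q` — the free-tail lemma in positive / negative form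
  (equivalent: `satelliteRecurrence_iff_noIsolatedFreeTail`);
* `NoIsolatedBandRun3` — K2 at `q = p = 3`: no all-isolated Step0 chain lives in `ordZero F = 4`;
* `ShapeLemma3` — (SH3); and the assembly `noIsolatedBandRun3_of : NoIsolatedFreeTail 3 → ShapeLemma3 →
  NoIsolatedBandRun3`; `exists_witnesses` (every Step0 chain has witnesses).

Written by res-dim4-idea-7 (sketch sha16 e460a65b386a7a24); filed verbatim by res-dim4-typ-1 (header and
linter line only).  Supports stmt-ResolutionOfSingularities-16155 (helper).
bears_on: LADDER-RESOLUTION:D157-DOOR2 (res-dim4-pi · I-7-2).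
-/

set_option linter.dupNamespace false -- mandated namespace of this single-conjunct summit

namespace Summit.ResolutionOfSingularities.ResolutionOfSingularities.Theorems.PIDim4

namespace FreeTail

open MvPolynomial Finset
open Literature.AlgebraicGeometry.Resolution
open Literature.AlgebraicGeometry.Resolution.CentreBlowup
open Literature.AlgebraicGeometry.Resolution.Hauser2010

variable {K : Type} [Field K]

/-- A Step0 chain together with its witnesses: chart `j k` and translation `b k` (with `b k (j k) = 0`)
producing `c (k+1)` from `c k` by the tree's `CentreBlowup.step` at the point centre `univ`. [OURS] -/
def IsWitnessedChain [DecidableEq K] (q : ℕ) (c : ℕ → State K) (j : ℕ → Fin 4)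
    (b : ℕ → Fin 4 → K) : Prop :=
  ∀ k, (q : ℕ∞) ≤ ordAlong Finset.univ (c k).F ∧ b k (j k) = 0 ∧
    IsEquimultiplePoint q Finset.univ (j k) (b k) (c k) ∧
    (CentreBlowup.step q Finset.univ (j k) (b k) (c k)).F ≠ 0 ∧
    c (k + 1) = CentreBlowup.step q Finset.univ (j k) (b k) (c k)

/-- Step `k+1` is SATELLITE with respect to the exceptional hyperplane `{x_{j k} = 0}` created at step `k`:
it is taken in another chart and does not translate the coordinate `x_{j k}`, so `c (k+2)` still lies on
the strict transform of that hyperplane.  The negation is a FREE step (direction with non-zero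
`x_{j k}`-component). [OURS] -/
def IsSatellite (j : ℕ → Fin 4) (b : ℕ → Fin 4 → K) (k : ℕ) : Prop :=
  j (k + 1) ≠ j k ∧ b (k + 1) (j k) = 0

/-- **Free-tail lemma, positive form** (CARD I-7-2 (FT)): along an all-ISOLATED witnessed Step0 chain,
satellite steps occur beyond every index. [OURS · CANDIDATE · hand proof in cards/idea-7.md] -/
def SatelliteRecurrence (q : ℕ) : Prop :=
  ∀ (K : Type) [Field K] [DecidableEq K] (c : ℕ → State K) (j : ℕ → Fin 4) (b : ℕ → Fin 4 → K),
    IsWitnessedChain q c j b → (∀ k, IsIsolated q (c k).F) → ∀ k₀ : ℕ, ∃ k, k₀ ≤ k ∧ IsSatellite j b k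

/-- **Free-tail lemma, negative form**: a witnessed Step0 chain whose steps are all FREE from some index on
passes through a NON-isolated state. [OURS · CANDIDATE] -/
def NoIsolatedFreeTail (q : ℕ) : Prop :=
  ∀ (K : Type) [Field K] [DecidableEq K] (c : ℕ → State K) (j : ℕ → Fin 4) (b : ℕ → Fin 4 → K)
    (k₀ : ℕ), IsWitnessedChain q c j b → (∀ k, k₀ ≤ k → ¬ IsSatellite j b k) →
    ∃ k, ¬ IsIsolated q (c k).F

/-- The two forms are equivalent (pure logic). -/
theorem satelliteRecurrence_iff_noIsolatedFreeTail (q : ℕ) :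
    SatelliteRecurrence q ↔ NoIsolatedFreeTail q := by
  constructor
  · intro h K _ _ c j b k₀ hc hfree
    by_contra hiso
    push Not at hiso
    obtain ⟨k, hk, hsat⟩ := h K c j b hc hiso k₀
    exact hfree k hk hsat
  · intro h K _ _ c j b hc hiso k₀
    by_contra hno
    push Not at hno
    obtain ⟨k, hk⟩ := h K c j b k₀ hc (fun k hk0 => hno k hk0)
    exact hk (hiso k)

/-- Every Step0 chain admits witnesses (choice on the `∃ j b` inside `Edge`). -/
theorem exists_witnesses [DecidableEq K] {q : ℕ} {c : ℕ → State K}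
    (hc : ∀ k, Step0 q (c k) (c (k + 1))) :
    ∃ (j : ℕ → Fin 4) (b : ℕ → Fin 4 → K), IsWitnessedChain q c j b := by
  choose j b hb using fun k => (hc k).2
  refine ⟨j, b, fun k => ⟨(hc k).1, (hb k).2.1, (hb k).2.2.1, (hb k).2.2.2.1, (hb k).2.2.2.2⟩⟩

/-- **K2 at q = p = 3** (CARD I-7-1's band lemma, proved by hand in CARD I-7-2 from the free-tail lemma and
the shape lemma (SH3); assembled below as `noIsolatedBandRun3_of`): over a field of characteristic 3 there is no infinite Step0 chain of ISOLATED
3-fold states all of residual order `ordZero F = 4` (the band `q < ord₀F ≤ 2q − 2` of IB-1 at q = 3).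
[OURS · CANDIDATE] -/
def NoIsolatedBandRun3 : Prop :=
  ∀ (K : Type) [Field K] [CharP K 3] [DecidableEq K],
    ¬ ∃ c : ℕ → State K, ∀ k, IsIsolated 3 (c k).F ∧ Step0 3 (c k) (c (k + 1)) ∧
      ordZero (c k).F = (4 : ℕ∞)

/-- **Shape lemma (SH3)**, typed: at q = 3, if the states `c k`, `c (k+1)` of a witnessed chain both have
residual order 4 (so `(c (k+1)).F = x_{j k} · H` with `ord₀ H = 3`) and step `k+1` is SATELLITE with respect
to the hyperplane `{x_{j k} = 0}` created at step `k`, then `c (k+2)` — of the shape `x_{j (k+1)} · x_{j k} · G`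
with `G(0) = 0` — is NOT isolated: `Sing₃ ⊇ {x_{j (k+1)} = x_{j k} = 0, G = 0}`, of dimension ≥ 1 (Krull).
Isolation of `c k`, `c (k+1)` is not even needed. [OURS · CANDIDATE · hand proof in cards/idea-7.md] -/
def ShapeLemma3 : Prop :=
  ∀ (K : Type) [Field K] [CharP K 3] [DecidableEq K] (c : ℕ → State K) (j : ℕ → Fin 4)
    (b : ℕ → Fin 4 → K) (k : ℕ), IsWitnessedChain 3 c j b →
    ordZero (c k).F = (4 : ℕ∞) → ordZero (c (k + 1)).F = (4 : ℕ∞) →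
    IsSatellite j b k → ¬ IsIsolated 3 (c (k + 2)).F

/-- The assembly of CARD I-7-2's corollary: (FT) + (SH3) ⇒ K2(3).  Proof: in an all-isolated band chain,
(SH3) forbids satellite steps from index 1 on, so the chain is a free tail, contradicting (FT). -/
theorem noIsolatedBandRun3_of (hFT : NoIsolatedFreeTail 3) (hSH : ShapeLemma3) : NoIsolatedBandRun3 := by
  intro K _ _ _
  rintro ⟨c, hc⟩
  obtain ⟨j, b, hw⟩ := exists_witnesses (K := K) (fun k => (hc k).2.1)
  have hfree : ∀ k, 0 ≤ k → ¬ IsSatellite j b k := fun k _ hsat =>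
    hSH K c j b k hw (hc k).2.2 (hc (k + 1)).2.2 hsat (hc (k + 2)).1
  obtain ⟨k, hk⟩ := hFT K c j b 0 hw hfree
  exact hk (hc k).1

/-! ## Characteristic-`p` forms of the free-tail lemma (crit-1 K-A-09 repair, appended)

`SatelliteRecurrence q` / `NoIsolatedFreeTail q` above quantify over EVERY field, so they also speak
about the mismatched games (`char K ≠ p`, `q` not a power of `char K`) where cleaning is not a coordinate
change and CARD I-7-2's hand proof does not apply (res-dim4-crit-1, K-A-09).  The intended statements
carry `[CharP K p]`; they are typed here (suffix `At`), shown to follow from the char-free ones, and the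
K2(3) assembly is restated with the characteristic-3 hypothesis `NoIsolatedFreeTailAt 3 3` — the form a
prover should discharge.  Appended by res-dim4-typ-1; nothing above is changed. -/

/-- **Free-tail lemma at characteristic `p`, positive form**: along an all-ISOLATED witnessed Step0 chain
over a field of characteristic `p`, satellite steps occur beyond every index. [OURS · CANDIDATE] -/
def SatelliteRecurrenceAt (p q : ℕ) : Prop :=
  ∀ (K : Type) [Field K] [CharP K p] [DecidableEq K] (c : ℕ → State K) (j : ℕ → Fin 4)
    (b : ℕ → Fin 4 → K), IsWitnessedChain q c j b → (∀ k, IsIsolated q (c k).F) →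
    ∀ k₀ : ℕ, ∃ k, k₀ ≤ k ∧ IsSatellite j b k

/-- **Free-tail lemma at characteristic `p`, negative form**: over a field of characteristic `p`, a
witnessed Step0 chain whose steps are all FREE from some index on passes through a NON-isolated state.
[OURS · CANDIDATE] -/
def NoIsolatedFreeTailAt (p q : ℕ) : Prop :=
  ∀ (K : Type) [Field K] [CharP K p] [DecidableEq K] (c : ℕ → State K) (j : ℕ → Fin 4)
    (b : ℕ → Fin 4 → K) (k₀ : ℕ), IsWitnessedChain q c j b → (∀ k, k₀ ≤ k → ¬ IsSatellite j b k) →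
    ∃ k, ¬ IsIsolated q (c k).F

/-- The two characteristic-`p` forms are equivalent (pure logic). -/
theorem satelliteRecurrenceAt_iff_noIsolatedFreeTailAt (p q : ℕ) :
    SatelliteRecurrenceAt p q ↔ NoIsolatedFreeTailAt p q := by
  constructor
  · intro h K _ _ _ c j b k₀ hc hfree
    by_contra hiso
    push Not at hiso
    obtain ⟨k, hk, hsat⟩ := h K c j b hc hiso k₀
    exact hfree k hk hsat
  · intro h K _ _ _ c j b hc hiso k₀
    by_contra hno
    push Not at hno
    obtain ⟨k, hk⟩ := h K c j b k₀ hc (fun k hk0 => hno k hk0)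
    exact hk (hiso k)

/-- The char-free form implies the characteristic-`p` form (it merely forgets the `CharP` instance). -/
theorem noIsolatedFreeTailAt_of_noIsolatedFreeTail (p q : ℕ) (h : NoIsolatedFreeTail q) :
    NoIsolatedFreeTailAt p q :=
  fun K _ _ _ c j b k₀ hc hfree => h K c j b k₀ hc hfree

/-- The char-free form implies the characteristic-`p` form, positive version. -/
theorem satelliteRecurrenceAt_of_satelliteRecurrence (p q : ℕ) (h : SatelliteRecurrence q) :
    SatelliteRecurrenceAt p q :=
  fun K _ _ _ c j b hc hiso k₀ => h K c j b hc hiso k₀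

/-- **K2(3) from the characteristic-3 free-tail lemma and (SH3)** — the assembly `noIsolatedBandRun3_of`
with the hypothesis a prover should actually discharge (`NoIsolatedFreeTailAt 3 3`; same proof term,
`NoIsolatedBandRun3` already binds `[CharP K 3]`). -/
theorem noIsolatedBandRun3_of_charP (hFT : NoIsolatedFreeTailAt 3 3) (hSH : ShapeLemma3) :
    NoIsolatedBandRun3 := by
  intro K _ _ _
  rintro ⟨c, hc⟩
  obtain ⟨j, b, hw⟩ := exists_witnesses (K := K) (fun k => (hc k).2.1)
  have hfree : ∀ k, 0 ≤ k → ¬ IsSatellite j b k := fun k _ hsat =>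
    hSH K c j b k hw (hc k).2.2 (hc (k + 1)).2.2 hsat (hc (k + 2)).1
  obtain ⟨k, hk⟩ := hFT K c j b 0 hw hfree
  exact hk (hc k).1

end FreeTail

end Summit.ResolutionOfSingularities.ResolutionOfSingularities.Theorems.PIDim4
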